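import Literature.Barriers.FinalStateConjecture.NonSmoothNullInfinityLogBase
import HarnessLib

/-!
# Barrier catalogue `FinalStateConjecture`: the linear scattering problem on Schwarzschild —
# the logarithmic expansion (6.18) of `∂ᵥ(rφ)` at all orders (discharge of
# `SchwarzschildLinearScattering_logExpansion`)
(`Literature/Barriers/FinalStateConjecture/`, D-0021, D-0014; namespace
`Literature.Barriers.FinalStateConjecture`, sub-namespace `VExp` for the induction)

Kehrberger's Thm. 6.2, eq. (6.18) (arXiv:2105.08079v3): for the scattering solution `ψ = rφ` with data
`G` supported in `(v₁, v₂)` whose moments `I⁽ᵏ⁾[G]`, `k < n`, vanish, at fixed `u` near `𝓘⁻` and with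
all `v`-derivatives,
`∂ᵥψ = Σ_{i ≤ n} f_i(u)/r^{3+i} − (−1)ⁿ (n+3)! I⁽ⁿ⁾[G] M (log r − log|u|)/r^{4+n} + O(r^{−4−n})`.
The proof is the printed induction on `n` ("The crucial idea is to use time integrals", proof of
Thm. 6.2):

* `n = 0` is `VExp.logExpansion_base` (`NonSmoothNullInfinityLogBase.lean`);
* `n → n + 1` (`VExp.logExpansion_step_core`): with `ψ^T` the scattering solution of the
  time-integrated data `G^T` (moments shifted by one, `kehrbergerMoment_scatteringTimeIntegral`) and
  `ψ = T ψ^T = ∂ᵤψ^T + ∂ᵥψ^T` (`SchwarzschildLinearScattering_timeIntegral_holds`), the wave equation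
  gives `∂ᵥψ = ∂ᵥ²ψ^T − Vψ^T`; inserting the induction hypothesis for `∂ᵥψ^T`,
  `ψ^T(u,v) = ψ^T(u,∞) − ∫_v^∞ ∂ᵥψ^T` and the explicit tails of inverse powers
  (`NonSmoothNullInfinityVExpansion.lean`) yields an expansion of `∂ᵥψ` whose polynomial part is
  `VExp.stepPoly` (coefficients: smooth functions of `u` built from the `f_i^T` and `ψ^T(u,∞)`) and
  whose logarithmic coefficient is `−(n+4) c_n^T`, i.e. `c_{n+1} = (−1)^{n+1}(n+4)! I⁽ⁿ⁺¹⁾[G] M`;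
* `VExp.logExpansion_scatteringField` assembles the induction for the constructed field, and
  `SchwarzschildLinearScattering_logExpansion_holds` transfers it to any `IsScatteringSolution` by
  uniqueness.

## References

* L. M. A. Kehrberger, *The case against smooth null infinity I*, Ann. Henri Poincaré 23 (2022)
  829–921 = arXiv:2105.08079 (v3, 2023), Thm. 6.2 eq. (6.18) and its proof, eqs. (6.22)–(6.25).
  Key `Kehrberger2022AHP`.
-/

noncomputable section

open Set Filter Topology MeasureTheory intervalIntegral Function Asymptotics Polynomial
open Literature.Barriers.FinalStateConjecture.ScatDecay

namespace Literature.Barriers.FinalStateConjecture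

namespace VExp

/-! ### The polynomial of the induction step -/

/-- **The polynomial part of the induction step**: with `a = ψ^T(u, ∞)`, `g_i = f_i^T(u)` and the
logarithmic coefficient `c^T`,
`Q = −a·V(X) + Σ_{i ≤ n} g_i (δ(X^{3+i}) − V(X)·A_{3+i,n}) − c^T (X − 2MX²) X^{4+n}`. [folklore] -/
def stepPoly (M : ℝ) (n : ℕ) (cT a : ℝ) (g : ℕ → ℝ) : ℝ[X] :=
  -C a * potentialPoly M +
    (∑ i ∈ Finset.range (n + 1), C (g i) * (vDerivPoly M (X ^ (3 + i)) - potentialPoly M * tailPoly M (3 + i) n)) -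
    C cT * (logDerivPoly M * X ^ (4 + n))

/-- The coefficients of `stepPoly` are linear in `a`, `g_i`, `c^T`. [folklore] -/
lemma stepPoly_coeff (M : ℝ) (n : ℕ) (cT a : ℝ) (g : ℕ → ℝ) (k : ℕ) :
    (stepPoly M n cT a g).coeff k = -a * (potentialPoly M).coeff k +
      (∑ i ∈ Finset.range (n + 1), g i * (vDerivPoly M (X ^ (3 + i)) - potentialPoly M * tailPoly M (3 + i) n).coeff k) -
      cT * (logDerivPoly M * X ^ (4 + n)).coeff k := by
  simp only [stepPoly, coeff_add, coeff_sub, coeff_neg, finsetSum_coeff, coeff_C_mul, neg_mul]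

/-- `X³ ∣ stepPoly`. [folklore] -/
lemma X_pow_three_dvd_stepPoly (M : ℝ) (n : ℕ) (cT a : ℝ) (g : ℕ → ℝ) : X ^ 3 ∣ stepPoly M n cT a g := by
  have hV : X ^ 3 ∣ potentialPoly M := ⟨_, potentialPoly_eq_X_pow_mul M⟩
  refine dvd_sub (dvd_add (Dvd.dvd.mul_left hV _) (Finset.dvd_sum fun i _ ↦ Dvd.dvd.mul_left ?_ _)) ?_
  · refine dvd_sub ?_ (Dvd.dvd.mul_right hV _)
    exact (pow_dvd_pow X (by omega : 3 ≤ 3 + i + 1)).trans (X_pow_dvd_vDerivPoly (dvd_refl _))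
  · exact Dvd.dvd.mul_left ((pow_dvd_pow X (by omega : 3 ≤ 4 + n)).trans (dvd_mul_left _ _)) _

/-- `stepPoly` evaluated: the defining sum. [folklore] -/
lemma stepPoly_eval (M : ℝ) (n : ℕ) (cT a : ℝ) (g : ℕ → ℝ) (x : ℝ) :
    (stepPoly M n cT a g).eval x = -a * (potentialPoly M).eval x +
      (∑ i ∈ Finset.range (n + 1), g i * ((vDerivPoly M (X ^ (3 + i))).eval x -
        (potentialPoly M).eval x * (tailPoly M (3 + i) n).eval x)) -
      cT * ((logDerivPoly M).eval x * x ^ (4 + n)) := by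
  simp only [stepPoly, eval_add, eval_sub, eval_neg, eval_mul, eval_C, eval_finsetSum, eval_pow, eval_X, neg_mul]

/-! ### The induction step at fixed `u` -/

section Step

variable {M : ℝ} {r : ℝ → ℝ → ℝ} (hr : IsEFAreaRadius M r) (hM : 0 < M)
include hr hM

/-- **The induction step `n → n + 1` of (6.18) at fixed `u`** (proof of Thm. 6.2). Hypotheses: `χT`
is a radiation field on the exterior (`∂ᵤ∂ᵥχT = −VχT`, jointly smooth), `χ(u,·) = (∂ᵤ + ∂ᵥ)χT(u,·)`,
`χT(u, v) → a` as `v → ∞`, and the level-`n` expansion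
`∂ᵥχT(u,·) = Σ_{i ≤ n} g_i/r^{3+i} − c^T Λ/r^{4+n} + E^T`, `E^T ∈ IsRem (4+n)`. Conclusion: the
level-`n+1` expansion of `∂ᵥχ(u,·)` with polynomial part `stepPoly` and logarithmic coefficient
`−(n+4) c^T`. [cite: Kehrberger2022AHP, proof of Thm. 6.2] -/
theorem logExpansion_step_core {u : ℝ} {n : ℕ} {χ χT : ℝ → ℝ → ℝ} {a cT : ℝ} {g : ℕ → ℝ} {ET : ℝ → ℝ}
    (hχT : IsRadiationFieldOnSchwarzschild M r χT)
    (hTid : ∀ v, χ u v = partialU χT u v + partialV χT u v)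
    (hlim : Tendsto (fun v ↦ χT u v) atTop (𝓝 a))
    (hET : IsRem r u (4 + n) ET)
    (hexp : ∀ v, deriv (fun v' ↦ χT u v') v =
      (∑ i ∈ Finset.range (n + 1), g i * (r u v ^ (3 + i))⁻¹) - cT * logRatio r u v * (r u v ^ (4 + n))⁻¹ + ET v) :
    IsRem r u (4 + (n + 1)) (fun v ↦ deriv (fun v' ↦ χ u v') v -
      (∑ i ∈ Finset.range (n + 1 + 1), (stepPoly M n cT a g).coeff (3 + i) * (r u v ^ (3 + i))⁻¹) +
      (-((n : ℝ) + 4) * cT) * logRatio r u v * (r u v ^ (4 + (n + 1)))⁻¹) := by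
  have hs : ContDiff ℝ ((⊤ : ℕ∞) : WithTop ℕ∞) (Function.uncurry χT) := hχT.1
  set Q : ℝ[X] := stepPoly M n cT a g with hQdef
  -- abbreviations (opaque, with defining equations)
  obtain ⟨DT, hDTdef⟩ : ∃ DT : ℝ → ℝ, DT = fun v ↦ deriv (fun v' ↦ χT u v') v := ⟨_, rfl⟩
  obtain ⟨TE, hTEdef⟩ : ∃ TE : ℝ → ℝ, TE = fun v ↦ ∫ w in Ioi v, ET w := ⟨_, rfl⟩
  obtain ⟨TL, hTLdef⟩ : ∃ TL : ℝ → ℝ, TL = fun v ↦ ∫ w in Ioi v, logRatio r u w * (r u w ^ (4 + n))⁻¹ := ⟨_, rfl⟩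
  obtain ⟨Tq, hTqdef⟩ : ∃ Tq : ℕ → ℝ → ℝ, Tq = fun i v ↦ ∫ w in Ioi v, (r u w ^ (3 + i + n + 1))⁻¹ := ⟨_, rfl⟩
  have hDT_eq : DT = fun v ↦ (∑ i ∈ Finset.range (n + 1), g i * (r u v ^ (3 + i))⁻¹) -
      cT * (logRatio r u v * (r u v ^ (4 + n))⁻¹) + ET v := by
    rw [hDTdef]; funext v; rw [hexp v]; ring
  -- remainder-class facts
  have hpoly : ∀ j, IsRem r u j (fun v ↦ (r u v ^ j)⁻¹) := fun j ↦ isRem_inv_pow hr hM u j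
  have hlogf : IsRem r u ((1 + n) + 2) (fun v ↦ logRatio r u v * (r u v ^ (4 + n))⁻¹) := by
    have h := isRem_logRatio_mul_inv_pow hr hM u (3 + n)
    rwa [show 3 + n + 1 = 4 + n by ring, show 3 + n = 1 + n + 2 by ring] at h
  have hETf : IsRem r u ((2 + n) + 2) ET := by rwa [show 2 + n + 2 = 4 + n by ring]
  have hDT1 : IsRem r u (1 + 2) DT := by
    rw [hDT_eq]
    refine ((IsRem.sum (Finset.range (n + 1)) fun i _ ↦ ((hpoly (3 + i)).const_mul (g i)).mono hr hM
      (by omega : 1 + 2 ≤ 3 + i)).sub ((hlogf.const_mul cT).mono hr hM (by omega))).add (hET.mono hr hM (by omega))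
  have hTE_rem : IsRem r u (3 + n) TE := by
    rw [hTEdef, show 3 + n = 2 + n + 1 by ring]; exact hETf.tail hr hM
  have hTL_rem : IsRem r u (2 + n) TL := by
    rw [hTLdef, show 2 + n = 1 + n + 1 by ring]; exact hlogf.tail hr hM
  have hTq_rem : ∀ i, IsRem r u (3 + i + n) (Tq i) := fun i ↦ by
    have h : IsRem r u ((2 + i + n) + 2) (fun v ↦ (r u v ^ (3 + i + n + 1))⁻¹) := by
      rw [show 3 + i + n + 1 = 2 + i + n + 2 by ring]; exact hpoly _
    rw [hTqdef, show 3 + i + n = 2 + i + n + 1 by ring]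
    exact h.tail hr hM
  -- (E1) `∂ᵥχ(u,·) = −V χT(u,·) + ∂ᵥ DT`
  have hD : ∀ v, deriv (fun v' ↦ χ u v') v =
      -((potentialPoly M).eval (r u v)⁻¹) * χT u v + deriv DT v := by
    intro v
    have hfun : (fun v' ↦ χ u v') = fun v' ↦ partialU χT u v' + partialV χT u v' := funext hTid
    rw [hfun]
    have h1 : HasDerivAt (fun v' ↦ partialU χT u v') (partialV (partialU χT) u v) v :=
      hasDerivAt_partialV (contDiff_partialU hs) u v
    have h2 : HasDerivAt (fun v' ↦ partialV χT u v') (partialV (partialV χT) u v) v :=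
      hasDerivAt_partialV (contDiff_partialV hs) u v
    have h12' : HasDerivAt (fun v' ↦ partialU χT u v' + partialV χT u v')
        (partialV (partialU χT) u v + partialV (partialV χT) u v) v := h1.add h2
    rw [h12'.deriv, ← partialU_partialV_comm hs u v, hχT.partialU_partialV u v,
      efPotential_eq_neg_radialPotential, radialPotential_eq_eval hr hM, hDTdef]
    rfl
  -- (E2) `χT(u, v) = a − ∫_v^∞ DT`
  have hintDT : ∀ v, IntegrableOn DT (Ioi v) := hDT1.integrableOn_Ioi hr hM
  have hcDT : Continuous DT := hDT1.1.continuous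
  have hE2 : ∀ v, χT u v = a - ∫ w in Ioi v, DT w := by
    intro v
    have hftc : ∀ w, v ≤ w → χT u w - χT u v = ∫ x in v..w, DT x := by
      intro w _
      rw [intervalIntegral.integral_eq_sub_of_hasDerivAt (f := fun v' ↦ χT u v')
        (fun x _ ↦ by rw [hDTdef]; exact hasDerivAt_partialV hs u x) (hcDT.intervalIntegrable _ _)]
    have hlim1 : Tendsto (fun w ↦ χT u w - χT u v) atTop (𝓝 (a - χT u v)) := hlim.sub_const _
    have hlim2 : Tendsto (fun w ↦ ∫ x in v..w, DT x) atTop (𝓝 (∫ w in Ioi v, DT w)) :=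
      intervalIntegral_tendsto_integral_Ioi v (hintDT v) tendsto_id
    have heq : (fun w ↦ χT u w - χT u v) =ᶠ[atTop] fun w ↦ ∫ x in v..w, DT x := by
      filter_upwards [eventually_ge_atTop v] with w hw using hftc w hw
    have := tendsto_nhds_unique (hlim1.congr' heq) hlim2
    linarith
  -- (E3) the tail of `DT`
  have hintpoly : ∀ i v, IntegrableOn (fun w ↦ (r u w ^ (3 + i))⁻¹) (Ioi v) := fun i v ↦ by
    have h : IsRem r u ((1 + i) + 2) (fun w ↦ (r u w ^ (3 + i))⁻¹) := by
      rw [show 1 + i + 2 = 3 + i by ring]; exact hpoly _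
    exact h.integrableOn_Ioi hr hM v
  have hT : ∀ v, ∫ w in Ioi v, DT w = TE v + (∑ i ∈ Finset.range (n + 1), g i *
      (-(tailPoly M (3 + i) n).eval (r u v)⁻¹ - tailResidue M (3 + i) n * Tq i v)) - cT * TL v := by
    intro v
    have hF1 : IntegrableOn (fun w ↦ ∑ i ∈ Finset.range (n + 1), g i * (r u w ^ (3 + i))⁻¹) (Ioi v) :=
      integrable_finsetSum _ fun i _ ↦ (hintpoly i v).const_mul (g i)
    have hF2 : IntegrableOn (fun w ↦ cT * (logRatio r u w * (r u w ^ (4 + n))⁻¹)) (Ioi v) :=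
      (hlogf.integrableOn_Ioi hr hM v).const_mul cT
    have hF3 : IntegrableOn ET (Ioi v) := hETf.integrableOn_Ioi hr hM v
    have hF12 : IntegrableOn (fun w ↦ (∑ i ∈ Finset.range (n + 1), g i * (r u w ^ (3 + i))⁻¹) -
        cT * (logRatio r u w * (r u w ^ (4 + n))⁻¹)) (Ioi v) := hF1.sub hF2
    rw [hDT_eq, hTEdef, hTLdef, hTqdef]
    simp only
    rw [integral_add hF12 hF3, integral_sub hF1 hF2, MeasureTheory.integral_const_mul,
      integral_finsetSum _ (fun i _ ↦ (hintpoly i v).const_mul (g i))]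
    have hsum : ∑ i ∈ Finset.range (n + 1), ∫ w in Ioi v, g i * (r u w ^ (3 + i))⁻¹ =
        ∑ i ∈ Finset.range (n + 1), g i * (-(tailPoly M (3 + i) n).eval (r u v)⁻¹ -
          tailResidue M (3 + i) n * ∫ w in Ioi v, (r u w ^ (3 + i + n + 1))⁻¹) := by
      refine Finset.sum_congr rfl fun i _ ↦ ?_
      rw [MeasureTheory.integral_const_mul, integral_Ioi_inv_pow_eq hr hM u (by omega : 3 ≤ 3 + i) n v]
    rw [hsum]
    ring
  -- (E4) the derivative of `DT`
  have hDT' : ∀ v, deriv DT v = (∑ i ∈ Finset.range (n + 1), g i * (vDerivPoly M (X ^ (3 + i))).eval (r u v)⁻¹) -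
      cT * ((logDerivPoly M).eval (r u v)⁻¹ * (r u v ^ (4 + n))⁻¹ +
        logRatio r u v * (-((4 + n : ℕ) : ℝ) * (r u v ^ (4 + n + 1))⁻¹ + 2 * M * ((4 + n : ℕ) : ℝ) * (r u v ^ (4 + n + 2))⁻¹)) +
      deriv ET v := by
    intro v
    have hδ : ∀ i ∈ Finset.range (n + 1), HasDerivAt (fun w ↦ g i * (r u w ^ (3 + i))⁻¹)
        (g i * (vDerivPoly M (X ^ (3 + i))).eval (r u v)⁻¹) v := by
      intro i _
      have h := hasDerivAt_eval_invRadius_vDerivPoly hr hM (X ^ (3 + i)) u v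
      have hfun : (fun v' ↦ ((X : ℝ[X]) ^ (3 + i)).eval (r u v')⁻¹) = fun w ↦ (r u w ^ (3 + i))⁻¹ := by
        funext w; simp [inv_pow]
      rw [hfun] at h
      exact h.const_mul (g i)
    have h1 := HasDerivAt.fun_sum hδ
    have h2 := (hasDerivAt_logRatio_mul_inv_pow hr hM u v (4 + n)).const_mul cT
    have h3 : HasDerivAt ET (deriv ET v) v :=
      ((hET.1.differentiable (by simp)).differentiableAt).hasDerivAt
    rw [hDT_eq]
    exact ((h1.sub h2).add h3).deriv
  -- (E5) evaluation of the step polynomial at `ρ`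
  have hQ : ∀ v, Q.eval (r u v)⁻¹ = -a * (potentialPoly M).eval (r u v)⁻¹ +
      (∑ i ∈ Finset.range (n + 1), g i * ((vDerivPoly M (X ^ (3 + i))).eval (r u v)⁻¹ -
        (potentialPoly M).eval (r u v)⁻¹ * (tailPoly M (3 + i) n).eval (r u v)⁻¹)) -
      cT * ((logDerivPoly M).eval (r u v)⁻¹ * (r u v ^ (4 + n))⁻¹) := by
    intro v; rw [hQdef, stepPoly_eval, inv_pow]
  -- the remainder of order `5 + n`
  have hV3 : X ^ 3 ∣ potentialPoly M := ⟨_, potentialPoly_eq_X_pow_mul M⟩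
  have hRem : IsRem r u (4 + (n + 1)) (fun v ↦
      (potentialPoly M).eval (r u v)⁻¹ * TE v -
      (∑ i ∈ Finset.range (n + 1), g i * tailResidue M (3 + i) n * ((potentialPoly M).eval (r u v)⁻¹ * Tq i v)) -
      cT * ((potentialPoly M).eval (r u v)⁻¹ * TL v) + deriv ET v -
      2 * M * cT * ((4 + n : ℕ) : ℝ) * (logRatio r u v * (r u v ^ (4 + n + 2))⁻¹)) := by
    have t1 : IsRem r u (4 + (n + 1)) (fun v ↦ (potentialPoly M).eval (r u v)⁻¹ * TE v) :=
      (IsRem.eval_mul hr hM u hV3 hTE_rem).mono hr hM (by omega)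
    have t2 : IsRem r u (4 + (n + 1)) (fun v ↦ ∑ i ∈ Finset.range (n + 1),
        g i * tailResidue M (3 + i) n * ((potentialPoly M).eval (r u v)⁻¹ * Tq i v)) :=
      IsRem.sum _ fun i _ ↦ ((IsRem.eval_mul hr hM u hV3 (hTq_rem i)).mono hr hM (by omega)).const_mul _
    have t3 : IsRem r u (4 + (n + 1)) (fun v ↦ cT * ((potentialPoly M).eval (r u v)⁻¹ * TL v)) := by
      have h := (IsRem.eval_mul hr hM u hV3 hTL_rem).const_mul cT
      rwa [show 3 + (2 + n) = 4 + (n + 1) by ring] at h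
    have t4 : IsRem r u (4 + (n + 1)) (deriv ET) := by
      have h := hET.deriv; rwa [show 4 + n + 1 = 4 + (n + 1) by ring] at h
    have t5 : IsRem r u (4 + (n + 1)) (fun v ↦ 2 * M * cT * ((4 + n : ℕ) : ℝ) *
        (logRatio r u v * (r u v ^ (4 + n + 2))⁻¹)) := by
      have h := (isRem_logRatio_mul_inv_pow hr hM u (4 + n + 1)).const_mul (2 * M * cT * ((4 + n : ℕ) : ℝ))
      rwa [show 4 + n + 1 + 1 = 4 + n + 2 by ring, show 4 + n + 1 = 4 + (n + 1) by ring] at h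
    have h := (((t1.sub t2).sub t3).add t4).sub t5
    exact h
  -- the explicit part, normalised
  have hExpl : IsRem r u (4 + (n + 1)) (fun v ↦ Q.eval (r u v)⁻¹ -
      ∑ i ∈ Finset.range (n + 1 + 1), Q.coeff (3 + i) * (r u v ^ (3 + i))⁻¹) :=
    isRem_eval_sub_sum hr hM u (X_pow_three_dvd_stepPoly M n cT a g) (n + 1)
  -- the key pointwise identity
  have hfun : (fun v ↦ deriv (fun v' ↦ χ u v') v -
      (∑ i ∈ Finset.range (n + 1 + 1), Q.coeff (3 + i) * (r u v ^ (3 + i))⁻¹) +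
      (-((n : ℝ) + 4) * cT) * logRatio r u v * (r u v ^ (4 + (n + 1)))⁻¹) =
      fun v ↦ (Q.eval (r u v)⁻¹ - ∑ i ∈ Finset.range (n + 1 + 1), Q.coeff (3 + i) * (r u v ^ (3 + i))⁻¹) +
        ((potentialPoly M).eval (r u v)⁻¹ * TE v -
        (∑ i ∈ Finset.range (n + 1), g i * tailResidue M (3 + i) n * ((potentialPoly M).eval (r u v)⁻¹ * Tq i v)) -
        cT * ((potentialPoly M).eval (r u v)⁻¹ * TL v) + deriv ET v -
        2 * M * cT * ((4 + n : ℕ) : ℝ) * (logRatio r u v * (r u v ^ (4 + n + 2))⁻¹)) := by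
    funext v
    have eD := hD v
    have eE2 := hE2 v
    have eT := hT v
    have eDT := hDT' v
    have eQ := hQ v
    -- the sums: `V·Σ g(−A − γTq) + Σ gδ = Σ g(δ − V A) − Σ gγ(V Tq)`
    have eS : (potentialPoly M).eval (r u v)⁻¹ * (∑ i ∈ Finset.range (n + 1), g i *
        (-(tailPoly M (3 + i) n).eval (r u v)⁻¹ - tailResidue M (3 + i) n * Tq i v)) +
        (∑ i ∈ Finset.range (n + 1), g i * (vDerivPoly M (X ^ (3 + i))).eval (r u v)⁻¹) =
        (∑ i ∈ Finset.range (n + 1), g i * ((vDerivPoly M (X ^ (3 + i))).eval (r u v)⁻¹ -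
          (potentialPoly M).eval (r u v)⁻¹ * (tailPoly M (3 + i) n).eval (r u v)⁻¹)) -
        ∑ i ∈ Finset.range (n + 1), g i * tailResidue M (3 + i) n * ((potentialPoly M).eval (r u v)⁻¹ * Tq i v) := by
      rw [Finset.mul_sum, ← Finset.sum_add_distrib, ← Finset.sum_sub_distrib]
      exact Finset.sum_congr rfl fun i _ ↦ by ring
    rw [show 4 + (n + 1) = 4 + n + 1 by ring]
    push_cast at eDT ⊢
    linear_combination eD - (potentialPoly M).eval (r u v)⁻¹ * eE2 + (potentialPoly M).eval (r u v)⁻¹ * eT +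
      eDT - eQ + eS
  rw [hfun]
  exact hExpl.add hRem

end Step

/-! ### The induction -/

section Induction

variable {M : ℝ} {r : ℝ → ℝ → ℝ} {v₁ v₂ : ℝ} (hr : IsEFAreaRadius M r) (hM : 0 < M) (h12 : v₁ < v₂)
include hr hM h12

/-- **Kehrberger's (6.18) for the constructed scattering field, all orders** (induction on `n` via
time integrals; base `logExpansion_base`, step `logExpansion_step_core`): for smooth data `H`
supported in `(v₁, v₂)` with vanishing moments `I⁽ᵏ⁾[H]`, `k < n`, there are `U₀ < −1` and smooth
coefficients `f_i` on `(−∞, U₀)` with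
`∂ᵥχ(u,·) − Σ_{i ≤ n} f_i(u)/r^{3+i} + (−1)ⁿ(n+3)! I⁽ⁿ⁾[H] M Λ/r^{4+n} ∈ IsRem (4+n)` for `u < U₀`.
[cite: Kehrberger2022AHP, Thm. 6.2 eq. (6.18)] -/
theorem logExpansion_scatteringField : ∀ (n : ℕ) {H : ℝ → ℝ} {CH : ℝ}
    (hHd : ContDiff ℝ ((⊤ : ℕ∞) : WithTop ℕ∞) H) (hsupp : tsupport H ⊆ Ioo v₁ v₂) (hHb : ∀ v, |H v| ≤ CH),
    (∀ k < n, kehrbergerMoment M H k = 0) →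
    ∃ U₀ : ℝ, U₀ < -1 ∧ ∃ f : ℕ → ℝ → ℝ, (∀ i, ContDiffOn ℝ ((⊤ : ℕ∞) : WithTop ℕ∞) (f i) (Iio U₀)) ∧
      ∀ u, u < U₀ → IsRem r u (4 + n) (fun v ↦
        deriv (fun v' ↦ scatteringField hr hM hHd.continuous hHb (data_eq_zero hsupp) u v') v -
        (∑ i ∈ Finset.range (n + 1), f i u * (r u v ^ (3 + i))⁻¹) +
        (-1) ^ n * ((n + 3).factorial : ℝ) * kehrbergerMoment M H n * M * logRatio r u v * (r u v ^ (4 + n))⁻¹) := by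
  intro n
  induction n with
  | zero =>
    intro H CH hHd hsupp hHb _
    obtain ⟨U₀, A, hU₀, hR⟩ := exists_goodRegion hr hM v₁ v₂
    obtain ⟨f₀, hf₀, hbase⟩ := logExpansion_base hr hM hHd hsupp hHb hR h12.le
    refine ⟨U₀, hU₀, fun i ↦ if i = 0 then f₀ else 0, fun i ↦ ?_, fun u hu ↦ ?_⟩
    · by_cases hi : i = 0
      · simp only [hi, if_true]; exact hf₀
      · simp only [hi, if_false]; exact contDiffOn_const
    · have hmom : kehrbergerMoment M H 0 = M * ∫ v' in v₁..v₂, H v' := by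
        rw [kehrbergerMoment_zero, ← scatteringTimeIntegral_eq_integral_of_le hsupp le_rfl,
          scatteringTimeIntegral_apply]
      have h := hbase u hu
      refine (show (fun v ↦ deriv (fun v' ↦ scatteringField hr hM hHd.continuous hHb (data_eq_zero hsupp) u v') v -
          (∑ i ∈ Finset.range (0 + 1), (if i = 0 then f₀ else 0) u * (r u v ^ (3 + i))⁻¹) +
          (-1) ^ 0 * ((0 + 3).factorial : ℝ) * kehrbergerMoment M H 0 * M * logRatio r u v * (r u v ^ (4 + 0))⁻¹) =
        fun v ↦ deriv (fun v' ↦ scatteringField hr hM hHd.continuous hHb (data_eq_zero hsupp) u v') v -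
          f₀ u * (r u v ^ 3)⁻¹ + 6 * (M * ∫ v' in v₁..v₂, H v') * M * logRatio r u v * (r u v ^ 4)⁻¹ from ?_) ▸ h
      funext v
      simp only [zero_add, Finset.range_one, Finset.sum_singleton, if_true, add_zero, pow_zero, one_mul,
        Nat.factorial, hmom]
      norm_num
  | succ n ih =>
    intro H CH hHd hsupp hHb hmom
    -- the time-integrated data
    have hM0 : M ≠ 0 := hM.ne'
    have h0 : ∫ v, H v = 0 := by
      have := hmom 0 (Nat.succ_pos n)
      rw [kehrbergerMoment_zero] at this
      exact (mul_eq_zero.1 this).resolve_left hM0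
    set HT := scatteringTimeIntegral v₁ H with hHT
    have hHTd : ContDiff ℝ ((⊤ : ℕ∞) : WithTop ℕ∞) HT := scatteringTimeIntegral_contDiff hHd v₁
    have hHTsupp : tsupport HT ⊆ Ioo v₁ v₂ := tsupport_scatteringTimeIntegral_subset hsupp h0
    obtain ⟨CHT, hHTb⟩ := exists_bound_of_tsupport hHTd.continuous hHTsupp
    have hmomT : ∀ k < n, kehrbergerMoment M HT k = 0 := fun k hk ↦ by
      rw [hHT, kehrbergerMoment_scatteringTimeIntegral hHd.continuous hsupp h0 M k]
      exact hmom (k + 1) (by omega)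
    have hmomTn : kehrbergerMoment M HT n = kehrbergerMoment M H (n + 1) :=
      kehrbergerMoment_scatteringTimeIntegral hHd.continuous hsupp h0 M n
    -- induction hypothesis for `χT`
    obtain ⟨U₀T, hU₀T, fT, hfT, hIH⟩ := ih hHTd hHTsupp hHTb hmomT
    -- the region for the future limit of `χT`
    obtain ⟨U₀', A', hU₀', hR'⟩ := exists_goodRegion hr hM v₁ v₂
    set χ := scatteringField hr hM hHd.continuous hHb (data_eq_zero hsupp) with hχ
    set χT := scatteringField hr hM hHTd.continuous hHTb (data_eq_zero hHTsupp) with hχT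
    set χTinf := scatFutureLimit M r v₁ χT with hχTinf
    set cT : ℝ := (-1) ^ n * ((n + 3).factorial : ℝ) * kehrbergerMoment M HT n * M with hcT
    have hsol := isScatteringSolution_scatteringField hr hM hHd hsupp hHb
    have hsolT := isScatteringSolution_scatteringField hr hM hHTd hHTsupp hHTb
    have hTid : ∀ u v, χ u v = partialU χT u v + partialV χT u v :=
      SchwarzschildLinearScattering_timeIntegral_holds M hM r hr H v₁ v₂ h12 hHd hsupp h0 χ χT hsol hsolT
    -- the new coefficients
    set f : ℕ → ℝ → ℝ := fun i u ↦ (stepPoly M n cT (χTinf u) (fun j ↦ fT j u)).coeff (3 + i) with hf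
    refine ⟨min U₀T U₀', lt_of_le_of_lt (min_le_left _ _) hU₀T, f, fun i ↦ ?_, fun u hu ↦ ?_⟩
    · -- smoothness of the coefficients
      have ha : ContDiffOn ℝ ((⊤ : ℕ∞) : WithTop ℕ∞) χTinf (Iio (min U₀T U₀')) :=
        (contDiffOn_futureLimit hr hM hHTd hHTsupp hHTb hR').mono (Iio_subset_Iio (min_le_right _ _))
      have hg : ∀ j, ContDiffOn ℝ ((⊤ : ℕ∞) : WithTop ℕ∞) (fT j) (Iio (min U₀T U₀')) := fun j ↦
        (hfT j).mono (Iio_subset_Iio (min_le_left _ _))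
      have hfun : f i = fun u ↦ -χTinf u * (potentialPoly M).coeff (3 + i) +
          (∑ j ∈ Finset.range (n + 1), fT j u * (vDerivPoly M (X ^ (3 + j)) -
            potentialPoly M * tailPoly M (3 + j) n).coeff (3 + i)) -
          cT * (logDerivPoly M * X ^ (4 + n)).coeff (3 + i) := by
        funext u; simp only [hf, stepPoly_coeff]
      rw [hfun]
      exact ((ha.neg.mul contDiffOn_const).add (ContDiffOn.sum fun j _ ↦ (hg j).mul contDiffOn_const)).sub
        contDiffOn_const
    · have huT : u < U₀T := lt_of_lt_of_le hu (min_le_left _ _)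
      have hu' : u < U₀' := lt_of_lt_of_le hu (min_le_right _ _)
      have hlim : Tendsto (fun v ↦ χT u v) atTop (𝓝 (χTinf u)) :=
        tendsto_futureLimit hr hM hHTd hHTsupp hHTb hR' hu'.le
      have hIHu := hIH u huT
      set ET : ℝ → ℝ := fun v ↦ deriv (fun v' ↦ χT u v') v -
        (∑ i ∈ Finset.range (n + 1), fT i u * (r u v ^ (3 + i))⁻¹) +
        (-1) ^ n * ((n + 3).factorial : ℝ) * kehrbergerMoment M HT n * M * logRatio r u v * (r u v ^ (4 + n))⁻¹ with hET
      have hexp : ∀ v, deriv (fun v' ↦ χT u v') v = (∑ i ∈ Finset.range (n + 1), fT i u * (r u v ^ (3 + i))⁻¹) -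
          cT * logRatio r u v * (r u v ^ (4 + n))⁻¹ + ET v := fun v ↦ by
        simp only [hET, hcT]; ring
      have hcore := logExpansion_step_core hr hM (χ := χ) (a := χTinf u) (g := fun j ↦ fT j u) hsolT.1
        (hTid u) hlim hIHu hexp
      -- identify the logarithmic coefficient `−(n+4) cT = (−1)^{n+1} (n+4)! I⁽ⁿ⁺¹⁾[H] M`
      have hcoef : -((n : ℝ) + 4) * cT = (-1) ^ (n + 1) * ((n + 1 + 3).factorial : ℝ) * kehrbergerMoment M H (n + 1) * M := by
        rw [hcT, hmomTn, show n + 1 + 3 = (n + 3) + 1 by ring, Nat.factorial_succ (n + 3)]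
        push_cast
        ring
      rw [hcoef] at hcore
      exact hcore

end Induction

end VExp

/-! ### Discharge of the named fact -/

/-- **Discharge of `SchwarzschildLinearScattering_logExpansion`** (Kehrberger, Thm. 6.2 eq. (6.18),
all orders, v3 sign): for every scattering solution (the constructed field, by uniqueness) with smooth
data supported in `(v₁, v₂)` and vanishing moments `k < n`, the expansion of `∂ᵥψ(u, ·)` towards `𝓘⁺`
with smooth coefficients `f_i` and the logarithmic term `−(−1)ⁿ(n+3)! I⁽ⁿ⁾[G] M (log r − log|u|)/r^{4+n}`
holds at every fixed `u < U₀`, together with all `v`-derivatives.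
[cite: Kehrberger2022AHP, Thm. 6.2 eq. (6.18)] -/
theorem SchwarzschildLinearScattering_logExpansion_holds : SchwarzschildLinearScattering_logExpansion := by
  intro M hM r hr G v₁ v₂ h12 hG hsupp n hmom ψ hψ
  obtain ⟨CG, hGb⟩ := exists_bound_of_tsupport hG.continuous hsupp
  have hsol := isScatteringSolution_scatteringField hr hM hG hsupp hGb
  have e := SchwarzschildLinearScattering_unique_holds M hM r hr G v₁ _ _ hψ hsol
  subst e
  obtain ⟨U₀, hU₀, f, hf, hmain⟩ := VExp.logExpansion_scatteringField hr hM h12 n hG hsupp hGb hmom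
  refine ⟨U₀, hU₀, f, hf, fun u hu m ↦ ?_⟩
  have h := (hmain u hu).isBigO_one_div m
  have hfun : (fun v ↦ deriv (fun v' ↦ scatteringField hr hM hG.continuous hGb (data_eq_zero hsupp) u v') v -
      (∑ i ∈ Finset.range (n + 1), f i u / r u v ^ (3 + i)) +
      (-1) ^ n * ((n + 3).factorial : ℝ) * kehrbergerMoment M G n * M *
        (Real.log (r u v) - Real.log |u|) / r u v ^ (4 + n)) =
      fun v ↦ deriv (fun v' ↦ scatteringField hr hM hG.continuous hGb (data_eq_zero hsupp) u v') v -
      (∑ i ∈ Finset.range (n + 1), f i u * (r u v ^ (3 + i))⁻¹) +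
      (-1) ^ n * ((n + 3).factorial : ℝ) * kehrbergerMoment M G n * M * VExp.logRatio r u v * (r u v ^ (4 + n))⁻¹ := by
    funext v
    simp only [div_eq_mul_inv, VExp.logRatio]
  rw [hfun]
  exact h

end Literature.Barriers.FinalStateConjecture

end
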